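import Literature.MathematicalPhysics.QuantumFieldTheory.PartiallyStochasticAcceptance
import HarnessLib

/-!
# Knechtli–Wolff, Appendix A (A.16): the closed form of the partially stochastic acceptance rate, and the two-eigenvalue example (4.15)

Topic `MathematicalPhysics/QuantumFieldTheory`; sequel of `PartiallyStochasticAcceptance.lean`
(`psdF lam S = F(λ; S)` (A.1) and its detailed balance (A.5)) and of
`StochasticAcceptanceSpectrum.lean` (the case `S = ∅`, `C = 0` of (A.16): Knechtli–Wolff (4.14); that
file numbers the displays differently — here equation numbers are those PRINTED in the arXiv version
hep-lat/0303001, read from its PDF).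
PUBLISHED RESULTS, proved here (no named fact is introduced, D-0026); wanted by the cell pub-lqcd
(venture `LatticeQCDFlow`, HOME/R2-SCOPE.md §2 row G1, §4 cost classes; the docstring of
`StochasticAcceptanceSpectrum.lean` records the partially stochastic case "with `C ≠ 0` … and the
two-eigenvalue estimate … NOT formalised").

The statements as printed.  Knechtli–Wolff, Nucl. Phys. B 663 (2003) 3, Appendix A: with
`F(λᵢ) = ∏_{i∈S̄}(∫₀^∞duᵢ) min[exp(−Σ_{i∈S̄}uᵢ), ∏_{i∈S}λᵢ⁻¹ exp(−Σ_{i∈S̄}λᵢuᵢ)]` (A.1) and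
`C = Σ_{i∈S} ln λᵢ` (A.3): "Assuming non degenerate `λᵢ` … The contour can be closed … in the right
or in the left half of the complex plane depending on whether `C` is positive or negative. … A short
calculation leads to the result
`F = ∏ₖλₖ⁻¹ + Σ_{i∈S̄, λᵢ<1} (1 − 1/λᵢ) e^{C/(λᵢ−1)} ∏_{j∈S̄, j≠i} (λᵢ−1)/(λᵢ−λⱼ)`   for `C > 0`;
`F = 1 − Σ_{i∈S̄, λᵢ>1} (1 − 1/λᵢ) e^{C/(λᵢ−1)} ∏_{j∈S̄, j≠i} (λᵢ−1)/(λᵢ−λⱼ)`        for `C < 0`  (A.16)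
["In the special case `C = 0` either closure of the contours is legitimate and the two expressions
coincide", after (A.8)].  Note that here the exponentials are both damping and may also be written as
`e^{C/(λᵢ−1)} = ∏_{k∈S} (λₖ)^{1/(λᵢ−1)}` (A.17)."  And §4.1, after (4.14): "It is clear from (4.13)
that eigenvalues `λᵢ = 1` are irrelevant for the acceptance.  Approaching this limit for one of them
in (4.14) one indeed finds it to drop out and one is left with the formula for `n − 1` eigenvalues.
If we now consider as an example the case of `λ₂ … λ_{n−1}` differing from one only negligibly and
only one remaining pair with `λₙ ≫ 1 > λ₁` then we find a small acceptance `⟨w₀⟩_η ≈ (2 − λ₁)/λₙ`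
(4.15).  It remains small even for `λ₁λₙ = 1 = det(M†M)`, when we have 100% non-stochastic
acceptance."

What is proved (finite form; `T = S̄`, the stochastic set, is a `Finset ι`; OUR road to (A.16) is the
probabilistic one of `StochasticAcceptanceSpectrum.lean`, not the residue theorem — deviation
recorded: `min(1, e^{−x}) = P{u₀ ≥ x}` for one more `Exp(1)` variable, conditioning on the level
`u₀ − C + Σ_{λᵢ<1}(1−λᵢ)uᵢ ≥ 0` (this is where `C ≤ 0` enters), the hypoexponential tail of the
`λᵢ > 1` group, and the exponential moments of the `λᵢ < 1` group; the `C ≥ 0` line then follows from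
the `C ≤ 0` line for the reciprocal spectrum by the detailed balance (A.5)):
* `kwWeightOn lam T i = ∏_{j∈T, j≠i} (λᵢ−1)/(λᵢ−λⱼ)` (the printed weight over `S̄`);
* **`integral_min_one_exp_neg_const_add_finsetSum`** — (A.16), `C ≤ 0`, on any probability space:
  for independent `uᵢ ∼ Exp(1)` and `λ` positive, `≠ 1` and injective on `T`,
  `E[min(1, exp(−C − Σ_{i∈T}(λᵢ−1)uᵢ))] = 1 − Σ_{i∈T, λᵢ>1}(1−1/λᵢ) e^{C/(λᵢ−1)} ∏_{j∈T,j≠i}(λᵢ−1)/(λᵢ−λⱼ)`;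
  `integral_min_one_exp_neg_finsetSum` : `C = 0` — "eigenvalues `λᵢ = 1` … drop out and one is left
  with the formula for" the remaining ones (the `uᵢ`, `i ∉ T`, do not enter);
* **`psdF_eq_one_sub`** (`∏_{k∈S}λₖ ≤ 1`, second line) and **`psdF_eq_inv_prod_add`**
  (`∏_{k∈S}λₖ ≥ 1`, first line): (A.16) for Knechtli–Wolff's `F(λ; S)` itself, with
  `e^{C/(λᵢ−1)}` written `exp(log(∏_{k∈S}λₖ)/(λᵢ−1))` (= `∏_{k∈S}λₖ^{1/(λᵢ−1)}`, (A.17):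
  `exp_log_prod_div_eq_rpow`); `sum_inv_mul_kwWeight` : the companion identity (A.18)
  `Σᵢ λᵢ⁻¹∏_{j≠i}(λᵢ−1)/(λᵢ−λⱼ) = ∏ₖλₖ⁻¹`, here = "the two expressions coincide" at `S = ∅`;
* **`integral_min_one_exp_neg_pair`** — the two-eigenvalue example behind (4.15): for
  `0 < λ₁ < 1 < λₙ` (all other `λᵢ = 1`),
  `⟨w₀⟩_η = (1−λ₁)/(λₙ−λ₁) + (λₙ−1)/(λₙ(λₙ−λ₁)) = (2−λ₁)/λₙ − (1−λ₁)²/(λₙ(λₙ−λ₁)) ≤ (2−λ₁)/λₙ`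
  (`pairAcceptance_eq`, `pairAcceptance_le`), and `= 2/(1+λₙ)` when `λ₁λₙ = 1`
  (`pairAcceptance_of_mul_eq_one`) — "small even for `λ₁λₙ = 1 = det(M†M)`".
Honest scope: degenerate spectra on `T` remain excluded ("assuming non degenerate `λᵢ`").

## References
* [KnechtliWolff2003] F. Knechtli, U. Wolff, Dynamical fermions as a global correction, Nucl. Phys.
  B 663 (2003) 3–32 (= hep-lat/0303001), §4.1 (4.13)–(4.15), Appendix A (A.1)–(A.5), (A.8),
  (A.16)–(A.18).
* [BuchholzKriegeFelko2014] P. Buchholz, J. Kriege, I. Felko, Input Modeling with Phase-Type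
  Distributions and Markov Models, Springer 2014, Ch. 2 eq. (2.24) (hypoexponential law).
* [Feller1971] W. Feller, An Introduction to Probability Theory and Its Applications II, 2nd ed.,
  Wiley 1971, Ch. I §3, §13 Problem 12.
-/

namespace Literature.MathematicalPhysics.QuantumFieldTheory.StochasticAcceptance

open MeasureTheory ProbabilityTheory Set Real
open Literature.Probability.Distributions
open scoped ENNReal

/-! ## The printed weights over the stochastic set `S̄ = T` -/

section Weights

variable {ι : Type*} [DecidableEq ι]

/-- The node change `μ = 1/(λ − 1)`: `μ_b/(μ_b − μ_a) = (a − 1)/(a − b)`. [folklore] -/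
private theorem node_identity' {a b : ℝ} (ha : a ≠ 1) (hb : b ≠ 1) (hab : a ≠ b) :
    (b - 1)⁻¹ / ((b - 1)⁻¹ - (a - 1)⁻¹) = (a - 1) / (a - b) := by
  have hx : a - 1 ≠ 0 := sub_ne_zero.mpr ha
  have hy : b - 1 ≠ 0 := sub_ne_zero.mpr hb
  have hxy : a - b ≠ 0 := sub_ne_zero.mpr hab
  have hden : (b - 1)⁻¹ - (a - 1)⁻¹ = (a - b) * ((a - 1)⁻¹ * (b - 1)⁻¹) := by
    calc (b - 1)⁻¹ - (a - 1)⁻¹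
        = ((a - 1) * (a - 1)⁻¹) * (b - 1)⁻¹ - ((b - 1) * (b - 1)⁻¹) * (a - 1)⁻¹ := by
          rw [mul_inv_cancel₀ hx, mul_inv_cancel₀ hy, one_mul, one_mul]
      _ = (a - b) * ((a - 1)⁻¹ * (b - 1)⁻¹) := by ring
  have hden0 : (a - b) * ((a - 1)⁻¹ * (b - 1)⁻¹) ≠ 0 :=
    mul_ne_zero hxy (mul_ne_zero (inv_ne_zero hx) (inv_ne_zero hy))
  rw [hden, div_eq_div_iff hden0 hxy]
  calc (b - 1)⁻¹ * (a - b) = (a - b) * (b - 1)⁻¹ * ((a - 1) * (a - 1)⁻¹) := by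
        rw [mul_inv_cancel₀ hx, mul_one, mul_comm]
    _ = (a - 1) * ((a - b) * ((a - 1)⁻¹ * (b - 1)⁻¹)) := by ring

/-- `1/(1 + 1/(λ − 1)) = 1 − 1/λ` for `λ ≠ 0, 1`. [folklore] -/
private theorem one_div_one_add_inv' {a : ℝ} (h0 : a ≠ 0) (h1 : a ≠ 1) :
    1 / (1 + (a - 1)⁻¹) = 1 - a⁻¹ := by
  have hx : a - 1 ≠ 0 := sub_ne_zero.mpr h1
  have e2 : 1 + (a - 1)⁻¹ = a * (a - 1)⁻¹ := by
    calc 1 + (a - 1)⁻¹ = (a - 1) * (a - 1)⁻¹ + (a - 1)⁻¹ := by rw [mul_inv_cancel₀ hx]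
      _ = a * (a - 1)⁻¹ := by ring
  have hne : a * (a - 1)⁻¹ ≠ 0 := mul_ne_zero h0 (inv_ne_zero hx)
  rw [e2, div_eq_iff hne]
  have e3 : (1 - a⁻¹) * (a * (a - 1)⁻¹) = (a - a⁻¹ * a) * (a - 1)⁻¹ := by ring
  rw [e3, inv_mul_cancel₀ h0, mul_inv_cancel₀ hx]

/-- Knechtli–Wolff's spectral weight over the stochastic set `S̄ = T`:
`∏_{j∈S̄, j≠i} (λᵢ − 1)/(λᵢ − λⱼ)`. [cite: KnechtliWolff2003, App. A eqs. (A.8), (A.16)] -/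
noncomputable def kwWeightOn (lam : ι → ℝ) (T : Finset ι) (i : ι) : ℝ :=
  ∏ j ∈ T.erase i, (lam i - 1) / (lam i - lam j)

/-- For `T` = all indices the weight is the one of (4.14) (`kwWeight` of
`StochasticAcceptanceSpectrum.lean`). [cite: KnechtliWolff2003, App. A (A.16)–(A.18), §4.1 (4.14)] -/
theorem kwWeightOn_univ [Fintype ι] (lam : ι → ℝ) (i : ι) :
    kwWeightOn lam Finset.univ i = kwWeight lam i := rfl

end Weights

/-! ## (A.16), second line (`C ≤ 0`), on a probability space -/

section Formula

variable {ι : Type*} [DecidableEq ι]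
variable {Ω : Type*} [MeasurableSpace Ω] {μ : Measure Ω} [IsProbabilityMeasure μ]

/-- The exponential law lives on `[0, ∞)`. [folklore] -/
private theorem ae_nonneg_expMeasure' (r : ℝ) : ∀ᵐ v ∂(expMeasure r), (0 : ℝ) ≤ v := by
  rw [ae_iff]
  have : {v : ℝ | ¬ 0 ≤ v} = Iio 0 := by ext v; simp [not_le]
  rw [this, Hypoexponential.expMeasure_eq_withDensity, withDensity_apply _ measurableSet_Iio]
  exact lintegral_exponentialPDF_of_nonpos le_rfl

/-- **KNECHTLI–WOLFF (A.16), second line (`C ≤ 0`): the closed form of the partially stochastic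
acceptance for a given spectrum.**  For independent `uᵢ ∼ Exp(1)`, a finite stochastic set `T = S̄`
on which the eigenvalues `λᵢ` are positive, `≠ 1` and pairwise distinct, and a constant `C ≤ 0`
(`C = Σ_{i∈S} ln λᵢ`):
`E[min(1, exp(−C − Σ_{i∈T} (λᵢ − 1)uᵢ))] = 1 − Σ_{i∈T, λᵢ>1} (1 − 1/λᵢ) e^{C/(λᵢ−1)} ∏_{j∈T, j≠i} (λᵢ−1)/(λᵢ−λⱼ)`.
[cite: KnechtliWolff2003, App. A eqs. (A.1), (A.8), (A.16) (second line)] -/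
theorem integral_min_one_exp_neg_const_add_finsetSum {u : ι → Ω → ℝ} (hind : iIndepFun u μ)
    (hmeas : ∀ i, Measurable (u i)) (hlaw : ∀ i, μ.map (u i) = expMeasure 1) (T : Finset ι)
    {lam : ι → ℝ} (hpos : ∀ i ∈ T, 0 < lam i) (hne : ∀ i ∈ T, lam i ≠ 1)
    (hinj : Set.InjOn lam ↑T) {C : ℝ} (hC : C ≤ 0) :
    ∫ ω, min 1 (Real.exp (-(C + ∑ i ∈ T, (lam i - 1) * u i ω))) ∂μ
      = 1 - ∑ i ∈ T.filter (fun i => 1 < lam i),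
          (1 - (lam i)⁻¹) * Real.exp (C * (lam i - 1)⁻¹) * kwWeightOn lam T i := by
  classical
  -- the two groups of eigenvalues
  set neg : Finset ι := T.filter (fun i => 1 < lam i) with hneg
  set pos : Finset ι := T.filter (fun i => ¬ 1 < lam i) with hpos'
  have hmem_neg : ∀ i, i ∈ neg ↔ i ∈ T ∧ 1 < lam i := fun i => by simp [hneg]
  have hmem_pos : ∀ i, i ∈ pos ↔ i ∈ T ∧ lam i < 1 := fun i => by
    simp only [hpos', Finset.mem_filter, not_lt]
    exact ⟨fun ⟨hT, h⟩ => ⟨hT, lt_of_le_of_ne h (hne i hT)⟩, fun ⟨hT, h⟩ => ⟨hT, le_of_lt h⟩⟩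
  have hneg_sub : neg ⊆ T := Finset.filter_subset _ _
  have hpos_sub : pos ⊆ T := Finset.filter_subset _ _
  have hdisj : Disjoint pos neg := by
    rw [disjoint_comm]; exact Finset.disjoint_filter_filter_not _ _ _
  -- the scaled variables and the two partial sums
  set Xn : ι → Ω → ℝ := fun i ω => (lam i - 1) * u i ω with hXn
  set Xp : ι → Ω → ℝ := fun i ω => (1 - lam i) * u i ω with hXp
  have hXn_meas : ∀ i, Measurable (Xn i) := fun i => (hmeas i).const_mul _
  have hXp_meas : ∀ i, Measurable (Xp i) := fun i => (hmeas i).const_mul _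
  have hXn_ind : iIndepFun Xn μ :=
    hind.comp (fun i x => (lam i - 1) * x) fun i => measurable_const_mul _
  have hXp_ind : iIndepFun Xp μ :=
    hind.comp (fun i x => (1 - lam i) * x) fun i => measurable_const_mul _
  set Yn : Ω → ℝ := fun ω => ∑ i ∈ neg, Xn i ω with hYn
  set Yp : Ω → ℝ := fun ω => ∑ i ∈ pos, Xp i ω with hYp
  have hYn_meas : Measurable Yn := Finset.measurable_sum neg fun i _ => hXn_meas i
  have hYp_meas : Measurable Yp := Finset.measurable_sum pos fun i _ => hXp_meas i
  have hX_eq : ∀ ω, ∑ i ∈ T, (lam i - 1) * u i ω = Yn ω - Yp ω := by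
    intro ω
    rw [hYn, hYp, ← Finset.sum_filter_add_sum_filter_not T (fun i => 1 < lam i)]
    simp only [hXn, hXp]
    rw [sub_eq_add_neg, ← Finset.sum_neg_distrib]
    congr 1
    exact Finset.sum_congr rfl fun i _ => by ring
  -- nonnegativity a.s.
  have hu_nn : ∀ᵐ ω ∂μ, ∀ i ∈ T, 0 ≤ u i ω :=
    (Filter.eventually_all_finset T).mpr fun i _ =>
      Hypoexponential.ae_nonneg_of_map_eq_expMeasure (hmeas i) (hlaw i)
  have hYp_nn : ∀ᵐ ω ∂μ, 0 ≤ Yp ω := by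
    filter_upwards [hu_nn] with ω hω
    exact Finset.sum_nonneg fun i hi =>
      mul_nonneg (by have := ((hmem_pos i).mp hi).2; linarith) (hω i (hpos_sub hi))
  -- rates of the `λ > 1` group
  set r : ι → ℝ := fun i => (lam i - 1)⁻¹ with hr
  have hr_pos : ∀ i ∈ neg, 0 < r i := fun i hi => by
    have := ((hmem_neg i).mp hi).2; simp only [hr]; exact inv_pos.mpr (by linarith)
  have hr_inj : Set.InjOn r ↑neg := by
    intro a ha b hb h
    have h' : lam a - 1 = lam b - 1 := inv_injective h
    exact hinj (Finset.coe_subset.mpr hneg_sub ha) (Finset.coe_subset.mpr hneg_sub hb) (by linarith)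
  have hXn_law : ∀ i ∈ neg, μ.map (Xn i) = expMeasure (r i) := fun i hi =>
    map_const_mul_of_map_eq_expMeasure_one (hmeas i) (hlaw i)
      (by have := ((hmem_neg i).mp hi).2; linarith)
  -- the tail of the `λ > 1` group (hypoexponential)
  have htail : ∀ t, 0 ≤ t → μ.real {ω | t < Yn ω} = Hypoexponential.tail neg r t := by
    intro t ht
    have := Hypoexponential.measureReal_lt_sum_eq_tail_of_injOn hXn_ind hXn_meas neg hXn_law
      hr_pos hr_inj ht
    simpa only [hYn] using this
  -- Step 1: adjoin the auxiliary exponential and pass to the complementary event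
  haveI := isProbabilityMeasure_expMeasure (zero_lt_one' ℝ)
  have hX_meas : Measurable fun ω => C + ∑ i ∈ T, (lam i - 1) * u i ω :=
    measurable_const.add (Finset.measurable_sum _ fun i _ => (hmeas i).const_mul _)
  rw [integral_min_one_exp_neg_eq_integral hX_meas]
  have hcompl : ∀ v, μ.real {ω | C + ∑ i ∈ T, (lam i - 1) * u i ω ≤ v}
      = 1 - μ.real {ω | (v - C) + Yp ω < Yn ω} := by
    intro v
    have hset : {ω | C + ∑ i ∈ T, (lam i - 1) * u i ω ≤ v} = {ω | (v - C) + Yp ω < Yn ω}ᶜ := by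
      ext ω
      simp only [mem_setOf_eq, mem_compl_iff, not_lt, hX_eq ω]
      constructor <;> intro h <;> linarith
    have hms : MeasurableSet {ω | (v - C) + Yp ω < Yn ω} :=
      measurableSet_lt (measurable_const.add hYp_meas) hYn_meas
    rw [hset, measureReal_compl hms, probReal_univ]
  -- Step 2: condition on the level `t + Yp` (independent of `Yn`)
  have hindep : ∀ t : ℝ, IndepFun (fun ω => t + Yp ω) Yn μ := by
    intro t
    have h0 := hind.indepFun_finset pos neg hdisj hmeas
    have hφ : Measurable fun x : (↥pos → ℝ) => t + ∑ i : ↥pos, (1 - lam i) * x i := by fun_prop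
    have hψ : Measurable fun x : (↥neg → ℝ) => ∑ i : ↥neg, (lam i - 1) * x i := by fun_prop
    have h1 := h0.comp hφ hψ
    have e1 : ((fun x : (↥pos → ℝ) => t + ∑ i : ↥pos, (1 - lam i) * x i)
        ∘ fun (a : Ω) (i : ↥pos) => u i a) = fun ω => t + Yp ω := by
      funext ω
      simp only [Function.comp, hYp, hXp]
      rw [Finset.sum_coe_sort pos (fun i => (1 - lam i) * u i ω)]
    have e2 : ((fun x : (↥neg → ℝ) => ∑ i : ↥neg, (lam i - 1) * x i)
        ∘ fun (a : Ω) (i : ↥neg) => u i a) = Yn := by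
      funext ω
      simp only [Function.comp, hYn, hXn]
      rw [Finset.sum_coe_sort neg (fun i => (lam i - 1) * u i ω)]
    rw [e1, e2] at h1
    exact h1
  -- the exponential moments of the `λ < 1` group
  have hmgf : ∀ i ∈ neg, ∫ ω, Real.exp (-(r i * Yp ω)) ∂μ
      = ∏ j ∈ pos, (lam i - 1) / (lam i - lam j) := by
    intro i hi
    have hri : 0 < r i := hr_pos i hi
    have h1 : ∫ ω, Real.exp (-(r i * Yp ω)) ∂μ = mgf (∑ j ∈ pos, Xp j) μ (-(r i)) := by
      unfold mgf
      refine integral_congr_ae (ae_of_all _ fun ω => ?_)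
      simp only [hYp, Finset.sum_apply, neg_mul]
    rw [h1, hXp_ind.mgf_sum hXp_meas pos]
    refine Finset.prod_congr rfl fun j hj => ?_
    have hlj : lam j < 1 := ((hmem_pos j).mp hj).2
    have hli : 1 < lam i := ((hmem_neg i).mp hi).2
    rw [show Xp j = fun ω => (1 - lam j) * u j ω from rfl,
      mgf_const_mul_of_map_eq_expMeasure_one (hmeas j) (hlaw j) (by linarith) hri.le]
    simp only [hr]
    have h2 : lam i - 1 ≠ 0 := by linarith
    have h3 : lam i - lam j ≠ 0 := by linarith
    have hprod : (lam i - 1) * (1 + (lam i - 1)⁻¹ * (1 - lam j)) = lam i - lam j := by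
      rw [mul_add, mul_one, ← mul_assoc, mul_inv_cancel₀ h2, one_mul]
      ring
    have hA : 1 + (lam i - 1)⁻¹ * (1 - lam j) ≠ 0 := fun h => h3 (by rw [← hprod, h, mul_zero])
    rw [div_eq_div_iff hA h3, one_mul, hprod]
  -- Step 3: the conditional tail, integrated
  have hlevel : ∀ t, 0 ≤ t → μ.real {ω | t + Yp ω < Yn ω}
      = ∑ i ∈ neg, Hypoexponential.coeff neg r i * Real.exp (-(r i * t))
          * ∏ j ∈ pos, (lam i - 1) / (lam i - lam j) := by
    intro t ht
    rw [measureReal_lt_eq_integral (T := fun ω => t + Yp ω)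
      (by exact measurable_const.add hYp_meas) hYn_meas (hindep t)]
    have hae : (fun ω => (fun s => μ.real {ω' | s < Yn ω'}) (t + Yp ω))
        =ᵐ[μ] fun ω => ∑ i ∈ neg, Hypoexponential.coeff neg r i * Real.exp (-(r i * t))
          * Real.exp (-(r i * Yp ω)) := by
      filter_upwards [hYp_nn] with ω hω
      rw [htail (t + Yp ω) (by linarith), Hypoexponential.tail]
      refine Finset.sum_congr rfl fun i _ => ?_
      rw [mul_assoc, ← Real.exp_add]
      ring_nf
    rw [integral_congr_ae hae]
    have hint : ∀ i ∈ neg, Integrable (fun ω => Hypoexponential.coeff neg r i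
        * Real.exp (-(r i * t)) * Real.exp (-(r i * Yp ω))) μ := by
      intro i hi
      refine (Integrable.mono' (integrable_const (1 : ℝ)) (by fun_prop) ?_).const_mul _
      filter_upwards [hYp_nn] with ω hω
      rw [Real.norm_eq_abs, abs_of_nonneg (Real.exp_pos _).le, Real.exp_le_one_iff]
      have := hr_pos i hi
      nlinarith
    rw [integral_finsetSum _ hint]
    refine Finset.sum_congr rfl fun i hi => ?_
    rw [integral_const_mul, hmgf i hi]
  -- Step 4: integrate the level `v − C ≥ 0` against `Exp(1)(dv)`
  have hv_nn : ∀ᵐ v ∂(expMeasure 1), (0 : ℝ) ≤ v := ae_nonneg_expMeasure' 1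
  have hae2 : (fun v => μ.real {ω | C + ∑ i ∈ T, (lam i - 1) * u i ω ≤ v})
      =ᵐ[expMeasure 1] fun v => 1 - ∑ i ∈ neg, (Hypoexponential.coeff neg r i
          * (∏ j ∈ pos, (lam i - 1) / (lam i - lam j)) * Real.exp (C * r i))
          * Real.exp (-(r i * v)) := by
    filter_upwards [hv_nn] with v hv
    rw [hcompl v, hlevel (v - C) (by linarith)]
    congr 1
    refine Finset.sum_congr rfl fun i _ => ?_
    rw [show -(r i * (v - C)) = C * r i + -(r i * v) by ring, Real.exp_add]
    ring
  rw [integral_congr_ae hae2]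
  have hint2 : ∀ i ∈ neg, Integrable (fun v : ℝ => (Hypoexponential.coeff neg r i
      * (∏ j ∈ pos, (lam i - 1) / (lam i - lam j)) * Real.exp (C * r i))
      * Real.exp (-(r i * v))) (expMeasure 1) := by
    intro i hi
    refine (Integrable.mono' (integrable_const (1 : ℝ)) (by fun_prop) ?_).const_mul _
    filter_upwards [hv_nn] with v hv
    rw [Real.norm_eq_abs, abs_of_nonneg (Real.exp_pos _).le, Real.exp_le_one_iff]
    have := hr_pos i hi
    nlinarith
  rw [integral_sub (integrable_const _) (integrable_finsetSum _ hint2), integral_const, smul_eq_mul,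
    probReal_univ, one_mul, integral_finsetSum _ hint2]
  congr 1
  refine Finset.sum_congr rfl fun i hi => ?_
  have hiT : i ∈ T := hneg_sub hi
  have hli : 1 < lam i := ((hmem_neg i).mp hi).2
  rw [integral_const_mul, integral_exp_neg_mul_expMeasure one_pos (hr_pos i hi).le]
  -- Step 5: algebra — assemble the printed weight
  have hsplit : kwWeightOn lam T i = (∏ j ∈ pos, (lam i - 1) / (lam i - lam j))
      * ∏ j ∈ neg.erase i, (lam i - 1) / (lam i - lam j) := by
    unfold kwWeightOn
    rw [← Finset.prod_union (Finset.disjoint_of_subset_right (Finset.erase_subset i neg) hdisj)]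
    congr 1
    ext j
    simp only [Finset.mem_erase, Finset.mem_union]
    constructor
    · rintro ⟨hji, hjT⟩
      by_cases h : 1 < lam j
      · exact Or.inr ⟨hji, (hmem_neg j).mpr ⟨hjT, h⟩⟩
      · exact Or.inl ((hmem_pos j).mpr ⟨hjT, lt_of_le_of_ne (not_lt.mp h) (hne j hjT)⟩)
    · rintro (hj | ⟨hji, hj⟩)
      · refine ⟨?_, hpos_sub hj⟩
        rintro rfl
        have := ((hmem_pos j).mp hj).2
        linarith
      · exact ⟨hji, hneg_sub hj⟩
  have hcoeff : Hypoexponential.coeff neg r i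
      = ∏ j ∈ neg.erase i, (lam i - 1) / (lam i - lam j) := by
    unfold Hypoexponential.coeff
    refine Finset.prod_congr rfl fun j hj => ?_
    have hji : j ≠ i := Finset.ne_of_mem_erase hj
    have hjT : j ∈ T := hneg_sub (Finset.mem_of_mem_erase hj)
    simp only [hr]
    exact node_identity' (hne i hiT) (hne j hjT) fun h => hji (hinj hiT hjT h).symm
  have hkey : 1 / (1 + r i) = 1 - (lam i)⁻¹ := by
    simp only [hr]
    exact one_div_one_add_inv' (hpos i hiT).ne' (hne i hiT)
  rw [hsplit, hcoeff, hkey]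
  ring

/-- **(A.16) at `C = 0` over a finite stochastic set** — "eigenvalues `λᵢ = 1` are irrelevant for
the acceptance … one indeed finds it to drop out and one is left with the formula for" the others:
only the `uᵢ`, `i ∈ T`, enter, and
`E[min(1, exp(−Σ_{i∈T}(λᵢ − 1)uᵢ))] = 1 − Σ_{i∈T, λᵢ>1} (1 − 1/λᵢ) ∏_{j∈T, j≠i} (λᵢ−1)/(λᵢ−λⱼ)`.
[cite: KnechtliWolff2003, §4.1 (the paragraph after (4.14)); App. A (A.16)] -/
theorem integral_min_one_exp_neg_finsetSum {u : ι → Ω → ℝ} (hind : iIndepFun u μ)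
    (hmeas : ∀ i, Measurable (u i)) (hlaw : ∀ i, μ.map (u i) = expMeasure 1) (T : Finset ι)
    {lam : ι → ℝ} (hpos : ∀ i ∈ T, 0 < lam i) (hne : ∀ i ∈ T, lam i ≠ 1)
    (hinj : Set.InjOn lam ↑T) :
    ∫ ω, min 1 (Real.exp (-(∑ i ∈ T, (lam i - 1) * u i ω))) ∂μ
      = 1 - ∑ i ∈ T.filter (fun i => 1 < lam i), (1 - (lam i)⁻¹) * kwWeightOn lam T i := by
  have h := integral_min_one_exp_neg_const_add_finsetSum hind hmeas hlaw T hpos hne hinj le_rfl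
  simp only [zero_add, zero_mul, Real.exp_zero, mul_one] at h
  exact h

omit [DecidableEq ι] in
/-- **"Eigenvalues `λᵢ = 1` drop out"**: if `λᵢ = 1` off `T`, the full sum `Σᵢ (λᵢ − 1)uᵢ` is the
sum over `T`. [cite: KnechtliWolff2003, §4.1 (the paragraph after (4.14))] -/
theorem sum_eq_finsetSum_of_eq_one [Fintype ι] {lam : ι → ℝ} {T : Finset ι}
    (hone : ∀ i ∉ T, lam i = 1) (x : ι → ℝ) :
    ∑ i, (lam i - 1) * x i = ∑ i ∈ T, (lam i - 1) * x i := by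
  rw [← Finset.sum_subset (Finset.subset_univ T)]
  intro i _ hi
  rw [hone i hi, sub_self, zero_mul]

end Formula

/-! ## (A.16) for Knechtli–Wolff's `F(λ; S)` on the product space -/

section PSD

variable {ι : Type*} [Fintype ι] [DecidableEq ι]

/-- `Exp(1)` is a probability law. [folklore] -/
private theorem isProbabilityMeasure_expMeasure_one'' : IsProbabilityMeasure (expMeasure 1) :=
  isProbabilityMeasure_expMeasure one_pos

attribute [local instance] isProbabilityMeasure_expMeasure_one''

/-- (A.16), second line, on the product space `⊗ᵢ Exp(1)` (= the weights `∏ e^{−uᵢ}duᵢ` of (A.1)).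
[cite: KnechtliWolff2003, App. A (A.1), (A.16)] -/
theorem integral_pi_min_one_exp_neg_const_add_finsetSum (T : Finset ι) {lam : ι → ℝ}
    (hpos : ∀ i ∈ T, 0 < lam i) (hne : ∀ i ∈ T, lam i ≠ 1) (hinj : Set.InjOn lam ↑T)
    {C : ℝ} (hC : C ≤ 0) :
    ∫ u, min 1 (Real.exp (-(C + ∑ i ∈ T, (lam i - 1) * u i)))
        ∂(Measure.pi fun _ : ι => expMeasure 1)
      = 1 - ∑ i ∈ T.filter (fun i => 1 < lam i),
          (1 - (lam i)⁻¹) * Real.exp (C * (lam i - 1)⁻¹) * kwWeightOn lam T i := by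
  have hind : iIndepFun (fun (i : ι) (u : ι → ℝ) => u i) (Measure.pi fun _ : ι => expMeasure 1) :=
    iIndepFun_pi (X := fun (_ : ι) (x : ℝ) => x) fun _ => aemeasurable_id
  have hlaw : ∀ i, (Measure.pi fun _ : ι => expMeasure 1).map (fun u : ι → ℝ => u i)
      = expMeasure 1 :=
    fun i => (measurePreserving_eval (fun _ : ι => expMeasure 1) i).map_eq
  exact integral_min_one_exp_neg_const_add_finsetSum hind (fun i => measurable_pi_apply i) hlaw T
    hpos hne hinj hC

/-- `F(λ; S)` written with `C = log ∏_{k∈S} λₖ` (A.3): `∏_S λₖ⁻¹ · e^{−X} = e^{−(C + X)}`.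
[cite: KnechtliWolff2003, App. A (A.1), (A.3)] -/
theorem psdF_eq_integral_exp_neg_log_add {lam : ι → ℝ} {S : Finset ι} (hS : ∀ i ∈ S, 0 < lam i) :
    psdF lam S = ∫ u, min 1 (Real.exp (-(Real.log (∏ k ∈ S, lam k)
        + ∑ i ∈ Sᶜ, (lam i - 1) * u i))) ∂(Measure.pi fun _ : ι => expMeasure 1) := by
  have hP : 0 < ∏ k ∈ S, lam k := Finset.prod_pos hS
  rw [psdF]
  refine integral_congr_ae (ae_of_all _ fun u => ?_)
  beta_reduce
  rw [neg_add, Real.exp_add, show Real.exp (-Real.log (∏ k ∈ S, lam k)) = (∏ k ∈ S, lam k)⁻¹ by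
    rw [Real.exp_neg, Real.exp_log hP]]

/-- **(A.16), second line, for `F(λ; S)`** (`C = Σ_{k∈S} ln λₖ ≤ 0`, i.e. `∏_{k∈S}λₖ ≤ 1`):
`F(λ; S) = 1 − Σ_{i∈S̄, λᵢ>1} (1 − 1/λᵢ) e^{C/(λᵢ−1)} ∏_{j∈S̄, j≠i} (λᵢ−1)/(λᵢ−λⱼ)` with
`e^{C/(λᵢ−1)} = exp(log(∏_{k∈S}λₖ)/(λᵢ−1)) = ∏_{k∈S}λₖ^{1/(λᵢ−1)}`.
[cite: KnechtliWolff2003, App. A eqs. (A.16) (second line), (A.17)] -/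
theorem psdF_eq_one_sub {lam : ι → ℝ} {S : Finset ι} (hpos : ∀ i, 0 < lam i)
    (hne : ∀ i ∈ Sᶜ, lam i ≠ 1) (hinj : Set.InjOn lam ↑Sᶜ) (hle : ∏ k ∈ S, lam k ≤ 1) :
    psdF lam S = 1 - ∑ i ∈ Sᶜ.filter (fun i => 1 < lam i),
      (1 - (lam i)⁻¹) * Real.exp (Real.log (∏ k ∈ S, lam k) * (lam i - 1)⁻¹)
        * kwWeightOn lam Sᶜ i := by
  rw [psdF_eq_integral_exp_neg_log_add fun i _ => hpos i]
  exact integral_pi_min_one_exp_neg_const_add_finsetSum Sᶜ (fun i _ => hpos i) hne hinj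
    (Real.log_nonpos (Finset.prod_nonneg fun i _ => (hpos i).le) hle)

omit [Fintype ι] [DecidableEq ι] in
/-- **(A.17)**: `exp(log(∏_{k∈S}λₖ)/(λᵢ−1)) = (∏_{k∈S}λₖ)^{1/(λᵢ−1)}` — "the exponentials … may also be
written as `e^{C/(λᵢ−1)} = ∏_{k∈S}(λₖ)^{1/(λᵢ−1)}`". [cite: KnechtliWolff2003, App. A eq. (A.17)] -/
theorem exp_log_prod_div_eq_rpow {lam : ι → ℝ} {S : Finset ι} (hS : ∀ i ∈ S, 0 < lam i) (x : ℝ) :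
    Real.exp (Real.log (∏ k ∈ S, lam k) * x) = (∏ k ∈ S, lam k) ^ x :=
  (Real.rpow_def_of_pos (Finset.prod_pos hS) x).symm

omit [Fintype ι] in
/-- The weights of the reciprocal spectrum: `(1/λᵢ − 1)/(1/λᵢ − 1/λⱼ) = λⱼ (λᵢ − 1)/(λᵢ − λⱼ)`, hence
`kwWeightOn λ⁻¹ T i = (∏_{j∈T, j≠i} λⱼ) · kwWeightOn λ T i`. [folklore] -/
private theorem kwWeightOn_inv {lam : ι → ℝ} {T : Finset ι} (hpos : ∀ i ∈ T, 0 < lam i)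
    (hinj : Set.InjOn lam ↑T) {i : ι} (hi : i ∈ T) :
    kwWeightOn (fun j => (lam j)⁻¹) T i = (∏ j ∈ T.erase i, lam j) * kwWeightOn lam T i := by
  unfold kwWeightOn
  rw [← Finset.prod_mul_distrib]
  refine Finset.prod_congr rfl fun j hj => ?_
  have hji : j ≠ i := Finset.ne_of_mem_erase hj
  have hjT : j ∈ T := Finset.mem_of_mem_erase hj
  have hli : lam i ≠ 0 := (hpos i hi).ne'
  have hlj : lam j ≠ 0 := (hpos j hjT).ne'
  have hij : lam i - lam j ≠ 0 := sub_ne_zero.mpr fun h => hji (hinj hjT hi h.symm)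
  have hij' : (lam i)⁻¹ - (lam j)⁻¹ ≠ 0 := by
    rw [sub_ne_zero]
    exact fun h => hji (hinj hjT hi (inv_injective h).symm)
  show ((lam i)⁻¹ - 1) / ((lam i)⁻¹ - (lam j)⁻¹) = lam j * ((lam i - 1) / (lam i - lam j))
  have hji' : lam j - lam i ≠ 0 := sub_ne_zero.mpr fun h => hji (hinj hjT hi h)
  rw [div_eq_iff hij']
  field_simp
  ring

/-- **(A.16), first line, for `F(λ; S)`** (`C = Σ_{k∈S} ln λₖ ≥ 0`, i.e. `∏_{k∈S}λₖ ≥ 1`):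
`F(λ; S) = ∏ₖ λₖ⁻¹ + Σ_{i∈S̄, λᵢ<1} (1 − 1/λᵢ) e^{C/(λᵢ−1)} ∏_{j∈S̄, j≠i} (λᵢ−1)/(λᵢ−λⱼ)`
(`∏ₖ` over ALL eigenvalues).  Obtained here from the second line for the reciprocal spectrum by the
detailed balance `F(λ; S) = (∏λ)⁻¹F(λ⁻¹; S)` (A.5).
[cite: KnechtliWolff2003, App. A eqs. (A.4)–(A.5), (A.16) (first line), (A.17)] -/
theorem psdF_eq_inv_prod_add {lam : ι → ℝ} {S : Finset ι} (hpos : ∀ i, 0 < lam i)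
    (hne : ∀ i ∈ Sᶜ, lam i ≠ 1) (hinj : Set.InjOn lam ↑Sᶜ) (hge : 1 ≤ ∏ k ∈ S, lam k) :
    psdF lam S = (∏ k, lam k)⁻¹ + ∑ i ∈ Sᶜ.filter (fun i => lam i < 1),
      (1 - (lam i)⁻¹) * Real.exp (Real.log (∏ k ∈ S, lam k) * (lam i - 1)⁻¹)
        * kwWeightOn lam Sᶜ i := by
  have hpos' : ∀ i, 0 < (lam i)⁻¹ := fun i => inv_pos.mpr (hpos i)
  have hne' : ∀ i ∈ Sᶜ, (lam i)⁻¹ ≠ 1 := fun i hi h => hne i hi (inv_eq_one.mp h)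
  have hinj' : Set.InjOn (fun j => (lam j)⁻¹) ↑Sᶜ := fun a ha b hb h => hinj ha hb (inv_injective h)
  have hP : 0 < ∏ k ∈ S, lam k := Finset.prod_pos fun i _ => hpos i
  have hle' : ∏ k ∈ S, (lam k)⁻¹ ≤ 1 := by
    rw [Finset.prod_inv_distrib]; exact inv_le_one_of_one_le₀ hge
  rw [psdF_eq_inv_prod_mul_psdF_inv hpos S, psdF_eq_one_sub hpos' hne' hinj' hle', mul_sub, mul_one,
    sub_eq_add_neg, ← mul_neg, ← Finset.sum_neg_distrib, Finset.mul_sum]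
  -- the two index sets `{1 < 1/λᵢ}` and `{λᵢ < 1}` coincide
  have hfilter : Sᶜ.filter (fun i => 1 < (lam i)⁻¹) = Sᶜ.filter (fun i => lam i < 1) := by
    ext i
    simp only [Finset.mem_filter, one_lt_inv₀ (hpos i)]
  rw [hfilter]
  congr 1
  refine Finset.sum_congr rfl fun i hi => ?_
  have hiS : i ∈ Sᶜ := (Finset.mem_filter.mp hi).1
  have hli1 : lam i < 1 := (Finset.mem_filter.mp hi).2
  have hli : lam i ≠ 0 := (hpos i).ne'
  have hli' : lam i - 1 ≠ 0 := sub_ne_zero.mpr (hne i hiS)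
  -- the exponential of the reciprocal data
  have hexp : Real.exp (Real.log (∏ k ∈ S, (lam k)⁻¹) * ((lam i)⁻¹ - 1)⁻¹)
      = (∏ k ∈ S, lam k) * Real.exp (Real.log (∏ k ∈ S, lam k) * (lam i - 1)⁻¹) := by
    rw [Finset.prod_inv_distrib, Real.log_inv]
    have hx : ((lam i)⁻¹ - 1)⁻¹ = -(1 + (lam i - 1)⁻¹) := by
      have e1 : (lam i)⁻¹ - 1 = (1 - lam i) * (lam i)⁻¹ := by
        rw [sub_mul, one_mul, mul_inv_cancel₀ hli]
      have e2 : 1 + (lam i - 1)⁻¹ = lam i * (lam i - 1)⁻¹ := by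
        calc 1 + (lam i - 1)⁻¹ = (lam i - 1) * (lam i - 1)⁻¹ + (lam i - 1)⁻¹ := by
              rw [mul_inv_cancel₀ hli']
          _ = lam i * (lam i - 1)⁻¹ := by ring
      rw [e1, e2, mul_inv, inv_inv, show (1 - lam i) = -(lam i - 1) by ring, inv_neg]
      ring
    rw [hx, show -Real.log (∏ k ∈ S, lam k) * -(1 + (lam i - 1)⁻¹)
        = Real.log (∏ k ∈ S, lam k) + Real.log (∏ k ∈ S, lam k) * (lam i - 1)⁻¹ by ring,
      Real.exp_add, Real.exp_log hP]
  -- the product over all eigenvalues splits as `(∏_S λ) · λᵢ · ∏_{S̄∖i} λ`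
  have hprod : ∏ k, lam k = (∏ k ∈ S, lam k) * (lam i * ∏ j ∈ Sᶜ.erase i, lam j) := by
    rw [Finset.mul_prod_erase Sᶜ lam hiS, Finset.prod_mul_prod_compl]
  rw [kwWeightOn_inv (fun j _ => hpos j) hinj hiS, hexp, inv_inv, hprod]
  have hQ : ∏ j ∈ Sᶜ.erase i, lam j ≠ 0 := (Finset.prod_pos fun j _ => hpos j).ne'
  field_simp
  ring

/-- **(A.18), the "companion" of (A.9)**: `Σᵢ λᵢ⁻¹ ∏_{j≠i} (λᵢ−1)/(λᵢ−λⱼ) = ∏ₖ λₖ⁻¹` for pairwise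
distinct positive `λᵢ ≠ 1`, `n ≥ 1` — here obtained analytically: at `S = ∅` (`C = 0`, "either closure
of the contours is legitimate and the two expressions coincide") both lines of (A.16) give `F(λ; ∅)`,
and their difference is `(A.18) − (A.9)`. [cite: KnechtliWolff2003, App. A eqs. (A.9), (A.16), (A.18)] -/
theorem sum_inv_mul_kwWeight [Nonempty ι] {lam : ι → ℝ} (hpos : ∀ i, 0 < lam i)
    (hne : ∀ i, lam i ≠ 1) (hinj : Function.Injective lam) :
    ∑ i, (lam i)⁻¹ * kwWeight lam i = (∏ k, lam k)⁻¹ := by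
  have hne' : ∀ i ∈ (∅ : Finset ι)ᶜ, lam i ≠ 1 := fun i _ => hne i
  have hinj' : Set.InjOn lam ↑((∅ : Finset ι)ᶜ) := fun a _ b _ h => hinj h
  have h2 := psdF_eq_one_sub (S := ∅) hpos hne' hinj' (by simp)
  have h1 := psdF_eq_inv_prod_add (S := ∅) hpos hne' hinj' (by simp)
  rw [h2] at h1
  simp only [Finset.prod_empty, Real.log_one, zero_mul, Real.exp_zero, mul_one, Finset.compl_empty,
    kwWeightOn_univ] at h1
  -- `h1 : 1 − Σ_{λ>1} (1 − λ⁻¹) kw = (∏λ)⁻¹ + Σ_{λ<1} (1 − λ⁻¹) kw`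
  have hsplit : ∑ i, (1 - (lam i)⁻¹) * kwWeight lam i
      = ∑ i ∈ Finset.univ.filter (fun i => 1 < lam i), (1 - (lam i)⁻¹) * kwWeight lam i
        + ∑ i ∈ Finset.univ.filter (fun i => lam i < 1), (1 - (lam i)⁻¹) * kwWeight lam i := by
    rw [← Finset.sum_filter_add_sum_filter_not Finset.univ (fun i => 1 < lam i)]
    congr 1
    refine Finset.sum_congr (Finset.filter_congr fun i _ => ?_) fun _ _ => rfl
    exact ⟨fun h => lt_of_le_of_ne (not_lt.mp h) (hne i), fun h => not_lt.mpr h.le⟩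
  have hsum : ∑ i, (1 - (lam i)⁻¹) * kwWeight lam i = 1 - ∑ i, (lam i)⁻¹ * kwWeight lam i := by
    simp_rw [sub_mul, one_mul]
    rw [Finset.sum_sub_distrib, sum_kwWeight hne hinj]
  linarith [hsplit, hsum, h1]

end PSD

/-! ## The two-eigenvalue example (4.15) -/

section Pair

variable {ι : Type*} [DecidableEq ι]
variable {Ω : Type*} [MeasurableSpace Ω] {μ : Measure Ω} [IsProbabilityMeasure μ]

/-- The exact mean stochastic acceptance for two relevant eigenvalues `a = λ₁ < 1 < b = λₙ`:
`(1 − a)/(b − a) + (b − 1)/(b(b − a))`. [cite: KnechtliWolff2003, §4.1 (4.14)–(4.15)] -/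
noncomputable def pairAcceptance (a b : ℝ) : ℝ := (1 - a) / (b - a) + (b - 1) / (b * (b - a))

/-- **The two-eigenvalue example**: for independent `uᵢ ∼ Exp(1)`, two indices `i₁ ≠ i₂` and
`0 < λ_{i₁} = a < 1 < b = λ_{i₂}` ("only one remaining pair with `λₙ ≫ 1 > λ₁`"),
`E[min(1, exp(−(a − 1)u_{i₁} − (b − 1)u_{i₂}))] = (1 − a)/(b − a) + (b − 1)/(b(b − a))`
(= `Σᵢ min(1, 1/λᵢ) ∏_{j≠i} (λᵢ−1)/(λᵢ−λⱼ)` (4.14) over the pair).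
[cite: KnechtliWolff2003, §4.1 eqs. (4.14)–(4.15)] -/
theorem integral_min_one_exp_neg_pair {u : ι → Ω → ℝ} (hind : iIndepFun u μ)
    (hmeas : ∀ i, Measurable (u i)) (hlaw : ∀ i, μ.map (u i) = expMeasure 1)
    {i₁ i₂ : ι} (h12 : i₁ ≠ i₂) {lam : ι → ℝ} {a b : ℝ} (ha : 0 < a) (ha1 : a < 1) (hb1 : 1 < b)
    (h1 : lam i₁ = a) (h2 : lam i₂ = b) :
    ∫ ω, min 1 (Real.exp (-(∑ i ∈ ({i₁, i₂} : Finset ι), (lam i - 1) * u i ω))) ∂μ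
      = pairAcceptance a b := by
  have hpos : ∀ i ∈ ({i₁, i₂} : Finset ι), 0 < lam i := by
    intro i hi
    rcases Finset.mem_insert.mp hi with rfl | hi
    · rw [h1]; exact ha
    · rw [Finset.mem_singleton.mp hi, h2]; linarith
  have hne : ∀ i ∈ ({i₁, i₂} : Finset ι), lam i ≠ 1 := by
    intro i hi
    rcases Finset.mem_insert.mp hi with rfl | hi
    · rw [h1]; exact ha1.ne
    · rw [Finset.mem_singleton.mp hi, h2]; exact hb1.ne'
  have hinj : Set.InjOn lam ↑({i₁, i₂} : Finset ι) := by
    intro x hx y hy hxy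
    have hx' : x = i₁ ∨ x = i₂ := by simpa using hx
    have hy' : y = i₁ ∨ y = i₂ := by simpa using hy
    rcases hx' with rfl | rfl <;> rcases hy' with rfl | rfl
    · rfl
    · exfalso; rw [h1, h2] at hxy; linarith
    · exfalso; rw [h1, h2] at hxy; linarith
    · rfl
  rw [integral_min_one_exp_neg_finsetSum hind hmeas hlaw {i₁, i₂} hpos hne hinj]
  have hfilter : ({i₁, i₂} : Finset ι).filter (fun i => 1 < lam i) = {i₂} := by
    ext i
    simp only [Finset.mem_filter, Finset.mem_insert, Finset.mem_singleton]
    constructor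
    · rintro ⟨rfl | rfl, h⟩
      · rw [h1] at h; exfalso; linarith
      · rfl
    · rintro rfl; exact ⟨Or.inr rfl, by rw [h2]; exact hb1⟩
  have herase : ({i₁, i₂} : Finset ι).erase i₂ = {i₁} := by
    rw [Finset.erase_insert_of_ne h12, Finset.erase_singleton]
    rfl
  rw [hfilter, Finset.sum_singleton, kwWeightOn, herase, Finset.prod_singleton, h1, h2,
    pairAcceptance]
  have hb : b ≠ 0 := by linarith
  have hba : b - a ≠ 0 := by linarith
  field_simp
  ring

/-- **(4.15)**: `pairAcceptance a b = (2 − a)/b − (1 − a)²/(b(b − a))`, so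
`⟨w₀⟩_η ≈ (2 − λ₁)/λₙ` for `λₙ ≫ 1 > λ₁` (the correction is `O(λₙ⁻²)`), and exactly
`⟨w₀⟩_η ≤ (2 − λ₁)/λₙ`. [cite: KnechtliWolff2003, §4.1 eq. (4.15)] -/
theorem pairAcceptance_eq {a b : ℝ} (hb : 0 < b) (hab : a < b) :
    pairAcceptance a b = (2 - a) / b - (1 - a) ^ 2 / (b * (b - a)) := by
  have hb' : b ≠ 0 := hb.ne'
  have hba : b - a ≠ 0 := by linarith
  rw [pairAcceptance]
  field_simp
  ring

/-- **(4.15), as an inequality**: `⟨w₀⟩_η ≤ (2 − λ₁)/λₙ` ("a small acceptance").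
[cite: KnechtliWolff2003, §4.1 eq. (4.15)] -/
theorem pairAcceptance_le {a b : ℝ} (hb : 0 < b) (hab : a < b) :
    pairAcceptance a b ≤ (2 - a) / b := by
  rw [pairAcceptance_eq hb hab]
  have : 0 ≤ (1 - a) ^ 2 / (b * (b - a)) := div_nonneg (sq_nonneg _) (by nlinarith)
  linarith

/-- **"It remains small even for `λ₁λₙ = 1 = det(M†M)`, when we have 100% non-stochastic
acceptance"**: at `ab = 1` the stochastic acceptance is `2/(1 + b)` (`< 2/λₙ`), while the
exact-determinant acceptance `min(1, 1/(ab))` equals `1`. [cite: KnechtliWolff2003, §4.1 (4.15) and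
the sentence after it] -/
theorem pairAcceptance_of_mul_eq_one {a b : ℝ} (hb : 1 < b) (hab : a * b = 1) :
    pairAcceptance a b = 2 / (1 + b) ∧ min 1 (a * b)⁻¹ = 1 := by
  have hb0 : b ≠ 0 := by linarith
  have ha : a = b⁻¹ := eq_inv_of_mul_eq_one_left hab
  refine ⟨?_, by rw [hab, inv_one, min_self]⟩
  have hba : b - a ≠ 0 := by
    rw [ha]; have : b⁻¹ < 1 := inv_lt_one_of_one_lt₀ hb; linarith
  have h1b : 1 + b ≠ 0 := by linarith
  have hb2 : -1 + b ^ 2 ≠ 0 := by nlinarith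
  have hb2' : b ^ 2 - 1 ≠ 0 := by nlinarith
  have hb2'' : b * b - 1 ≠ 0 := by nlinarith
  rw [pairAcceptance, ha]
  field_simp
  ring

end Pair

end Literature.MathematicalPhysics.QuantumFieldTheory.StochasticAcceptance
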